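import Literature.AlgebraicGeometry.HodgeTheory.IntegralLineBundle
import Literature.AlgebraicGeometry.HodgeTheory.LefschetzOneOneOfKodairaSerre
import Literature.AlgebraicGeometry.HodgeTheory.KodairaSerreSectionsAllDim
import Literature.AlgebraicGeometry.HodgeTheory.LefschetzOneOneChowProofs
import Literature.AlgebraicGeometry.HodgeTheory.HodgeModelConnected
import Literature.AlgebraicTopology.SingularHomology.IntegralClassRingChange
import Literature.AlgebraicTopology.SingularHomology.CohomologyRingChange
import HarnessLib

/-!
# The Lefschetz theorem on `(1,1)`-classes with INTEGRAL coefficients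

C. Voisin, *Hodge Theory and Complex Algebraic Geometry I* (2002), Thm. 11.30 with Remark 7.9 and
Thm. 11.33: on a smooth projective complex variety `X`, an integral class `z ∈ H²(X(ℂ); ℤ)` whose
complexification is of Hodge type `(1,1)` is the first Chern class of a holomorphic — hence
algebraic — line bundle `𝒪_X(D)`, and therefore DIES ON A NON-EMPTY ZARISKI OPEN subset (off the
support of `D`), torsion classes included. The tree had the theorem with rational coefficients
(`lefschetzOneOne_rational_holds`, the complexified class is supported on a divisor), which is blind
to torsion; this file proves the integral statement:

* `map_π_eq_zero_of_units` — the topological end: with the integer Čech cocycle `b` of an integer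
  singular cocycle `ζ` on an open cover (collating zigzag `Y`) and an exponential cocycle `exp G`,
  `G_ij + G_jk − G_ik = −2πi b_ijk`, which is a coboundary of continuous units on an open `W`, the
  class of `ζ` restricts to `0` in `H²(W; ℤ)` (`ExpCocycleWinding` + `CechToSingular`);
* `integralClass_oneOne_map_eq_zero_hodgeModel` — on a Hodge model of a smooth projective `X`, an
  integral class with `(1,1)` complexification restricts to `0` off a proper closed analytic subset
  (the exponential cocycle of `IntegralLineBundle`, Kodaira–Serre sections of an algebraic twist,
  `σ₁/σ₂`);
* `integralLefschetzOneOne` — **for `X` smooth projective over `ℂ` and `z ∈ H²(X(ℂ); ℤ)` with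
  `z ⊗ ℂ` of Hodge type `(1,1)`, there is a Zariski-closed `Z ≠ X` with `z|_{(X ∖ Z)(ℂ)} = 0`**
  (Chow's theorem for the analytic set).

No named facts; everything is proved.

## References

* C. Voisin, *Hodge Theory and Complex Algebraic Geometry I*, CUP 2002, §7.1.3 Remark 7.9,
  Thm. 11.30, Thm. 11.33, Cor. 11.34. [VoisinHodgeI2002]
* P. Griffiths, J. Harris, *Principles of Algebraic Geometry* (1978), pp. 139–141, 148–149.
  [GriffithsHarris1978]
* J.-P. Serre, *Géométrie algébrique et géométrie analytique* (1956), n° 16–19. [SerreGAGA1956]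
-/

noncomputable section

set_option backward.isDefEq.respectTransparency false

open scoped Manifold ContDiff Topology
open Set Filter Function
open Literature.Geometry.Kaehler hiding cechδ_apply cechd_apply cechδ cechd cechSet mem_cechSet_iff
open Literature.Geometry.Manifold
open Literature.NumberTheory.Transcendental
open Literature.Algebra.Homology
open Literature.AlgebraicTopology.SingularHomology hiding cechSet mem_cechSet_iff cechSet_subset_comp
  cechSet_subset_apply cechSet_cons

namespace Literature.AlgebraicGeometry.HodgeTheory

/-! ### The topological end: the class of `ζ` dies where the exponential cocycle is trivial -/

section Topology

variable {M : Type} [TopologicalSpace M] {ι : Type*}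

/-- The values of a cocycle satisfy the cocycle identity. [folklore] -/
theorem sum_face_eq_zero_of_cocycles (u : singularCochainComplex.cocycles ℤ ℤ M 2)
    (σ : SingularSimplex M 3) : ∑ i : Fin 4, (-1 : ℤ) ^ (i : ℕ) * coFn u (σ.face i) = 0 := by
  have h := congrFun (coboundary_coFn u) σ
  rw [coboundary_eq, singularCochainComplex.d_apply, Pi.zero_apply] at h
  simpa only [smul_eq_mul] using h

-- The generic-`R` lemmas of `CechToSingular` / `ExpCocycleWinding` meet the `ℤ`-specific statements
-- of `IntegralCechClass` here: the instance paths (`Int.instSemiring` vs `CommSemiring.toSemiring _`)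
-- agree only up to unfolding, inside large double-complex types — hence the raised limit.
set_option maxHeartbeats 400000 in
/-- **The class of `ζ` dies where the exponential cocycle is a coboundary of units.** Let `U` be an
open cover of `M`, `u` an integer singular `2`-cocycle (values `ζ`) with integer Čech cocycle `b` on `U` and
collating zigzag `Y` (as produced by `exists_intCech_of_intCocycle`), `G_ij` continuous on
`U_i ∩ U_j` with `G_ij + G_jk − G_ik = −2πi b_ijk`, and suppose `exp G` is a coboundary of continuous
units on the open `W`: `h_j = exp(G_ij) h_i` on `U_i ∩ U_j ∩ W`, `h_i` continuous and nowhere zero on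
`U_i ∩ W`. Then the class of `ζ` restricts to `0` in `H²(W; ℤ)`.
[cite: GriffithsHarris1978, pp. 139–141] [cite: VoisinHodgeI2002, Thm. 11.33 (proof)] -/
theorem map_π_eq_zero_of_units (U : ι → Set M) (hUo : ∀ i, IsOpen (U i)) (hcov : ∀ x, ∃ i, x ∈ U i)
    (u : singularCochainComplex.cocycles ℤ ℤ M 2)
    {b : ι → ι → ι → ℤ} {Y : ∀ p q, CechCochain ℤ IntCoeff U p q}
    (hb4 : ∀ i j k l, (U i ∩ U j ∩ U k ∩ U l).Nonempty → b j k l - b i k l + b i j l - b i j k = 0)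
    (hY : Y ∈ ADoubleComplex.Tn ℤ (X := CechCochain ℤ IntCoeff U) 1)
    (hbY : ADoubleComplex.single 0 2 ((cechSingularRow ℤ IntCoeff U).ε 2
          (toSmall ℤ IntCoeff U (fun _ ↦ subset_univ _) 2 (intCochain (coFn u)))) -
        ADoubleComplex.single 2 0 (cechZeroIncl ℤ IntCoeff U 2 (constCechCocycle U ℤ intCoeffHom b)) =
      (cechSingular ℤ IntCoeff U).totalD Y)
    (G : ι → ι → M → ℂ) (hGc : ∀ i j, ContinuousOn (G i j) (U i ∩ U j))
    (hGb : ∀ i j k, ∀ x ∈ U i ∩ U j ∩ U k,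
      G i j x + G j k x - G i k x = 2 * Real.pi * Complex.I * ((-b i j k : ℤ) : ℂ))
    {W : Set M} (hW : IsOpen W) (h : ι → M → ℂ) (hc : ∀ i, ContinuousOn (h i) (U i ∩ W))
    (h0 : ∀ i, ∀ x ∈ U i ∩ W, h i x ≠ 0)
    (hh : ∀ i j, ∀ x ∈ (U i ∩ W) ∩ (U j ∩ W), h j x = Complex.exp (G i j x) * h i x) :
    singularCohomology.map ℤ ℤ (valMap' W) 2 (singularCohomology.π ℤ ℤ M 2 u) = 0 := by
  classical
  have hζ := sum_face_eq_zero_of_cocycles u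
  -- (1) `c₁` of the trivialised exponential cocycle vanishes on `W` (winding cochains, applied to
  -- the inverse trivialisation `h⁻¹` of the inverse cocycle `exp(−G)`, whose integer cocycle is `b`)
  have hcocVb : constCechCocycle (fun i ↦ U i ∩ W) ℤ intCoeffHom b ∈ NatCochain.cocycles (cechZeroδ ℤ IntCoeff (fun i ↦ U i ∩ W)) 2 :=
    constCechCocycle_mem_cocycles (fun i ↦ U i ∩ W) intCoeffHom _ fun i j k l hne ↦ by
      have hne' : (U i ∩ U j ∩ U k ∩ U l).Nonempty := by
        obtain ⟨x, hx⟩ := hne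
        exact ⟨x, ⟨⟨hx.1.1.1.1, hx.1.1.2.1⟩, hx.1.2.1⟩, hx.2.1⟩
      exact hb4 i j k l hne'
  have hvan := cechToSmall_constCechCocycle_eq_zero_of_units (V := fun i ↦ U i ∩ W) intCoeffHom (fun i j x ↦ -G i j x)
    (fun i j ↦ ((hGc i j).mono fun x hx ↦ ⟨hx.1.1, hx.2.1⟩).neg) b
    (fun i j k x hx ↦ by
      have h := hGb i j k x ⟨⟨hx.1.1.1, hx.1.2.1⟩, hx.2.1⟩
      push_cast at h ⊢
      linear_combination -h)
    (fun i x ↦ (h i x)⁻¹) (fun i ↦ (hc i).inv₀ (h0 i)) (fun i x hx ↦ inv_ne_zero (h0 i x hx))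
    (fun i j x hx ↦ by
      rw [hh i j x hx, mul_inv, Complex.exp_neg])
    hcocVb
  -- (2) on `U`, the class of `(b)` under the Čech-to-small map is the class of `ζ`
  have hcocU : constCechCocycle U ℤ intCoeffHom b ∈ NatCochain.cocycles (cechZeroδ ℤ IntCoeff U) 2 :=
    constCechCocycle_mem_cocycles U intCoeffHom b hb4
  set a : SmallCochain ℤ IntCoeff U 2 := toSmall ℤ IntCoeff U (fun _ ↦ subset_univ _) 2 (intCochain (coFn u)) with ha
  have hac : a ∈ NatCochain.cocycles (cechSingularRow ℤ IntCoeff U).dA 2 :=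
    toSmall_mem_cocycles U _ (cod_intCochain (coFn u) hζ)
  have hclassU : cechToSmall U 2 (NatCochain.Cohomology.mk _ 2 ⟨_, hcocU⟩) =
      NatCochain.Cohomology.mk _ 2 ⟨a, hac⟩ := by
    rw [cechToSmall_mk_eq_mk_iff, ADoubleComplex.RowAugmentation.coe_εTot, ADoubleComplex.RowAugmentation.coe_εTot,
      ADoubleComplex.swapₗ_single, ADoubleComplex.totB_succ, Submodule.mem_map]
    exact ⟨Y, hY, hbY.symm⟩
  -- (3) restrict to `W`: the restricted Čech class is that of `(b)` on `(fun i ↦ U i ∩ W)`, which dies by (1)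
  have hresCol : (restrictColHom U W).cohMap 2 (NatCochain.Cohomology.mk (cechZeroδ ℤ IntCoeff U) 2 ⟨_, hcocU⟩) =
      NatCochain.Cohomology.mk (cechZeroδ ℤ IntCoeff (fun i ↦ U i ∩ W)) 2 ⟨_, hcocVb⟩ :=
    (ADoubleComplex.RowAugmentation.Hom.cohMap_mk (restrictColHom U W) 2 ⟨_, hcocU⟩).trans
      (congrArg (NatCochain.Cohomology.mk (cechZeroδ ℤ IntCoeff (fun i ↦ U i ∩ W)) 2)
        (Subtype.ext (funext fun J ↦ Subtype.ext (by
          change cres (cechSet_inter_subset U W J) 0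
              (intConstCochain ℤ intCoeffHom (Literature.AlgebraicTopology.SingularHomology.cechSet U J)
                (b (J 0) (J 1) (J 2))) =
            intConstCochain ℤ intCoeffHom (Literature.AlgebraicTopology.SingularHomology.cechSet (fun i ↦ U i ∩ W) J) (b (J 0) (J 1) (J 2))
          exact cres_intConstCochain intCoeffHom _ _))))
  have hres0 : (restrictRowHom U W).cohMap 2 (NatCochain.Cohomology.mk _ 2 ⟨a, hac⟩) = 0 := by
    rw [← hclassU, cechToSmall_restrict, hresCol]
    exact hvan
  -- (4) the restricted small cocycle is the small cocycle of `ζ|_W`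
  set ψW : CochainOn ℤ IntCoeff W 2 := cres (subset_univ W) 2 (intCochain (coFn u)) with hψW
  have hψWc : cod W 2 ψW = 0 := by rw [hψW, ← cres_cod, cod_intCochain (coFn u) hζ, map_zero]
  have hVW : ∀ i, (fun i ↦ U i ∩ W) i ⊆ W := fun i ↦ inter_subset_right
  have hsmall0 : NatCochain.Cohomology.mk (cechSingularRow ℤ IntCoeff (fun i ↦ U i ∩ W)).dA 2
      ⟨toSmall ℤ IntCoeff (fun i ↦ U i ∩ W) hVW 2 ψW, toSmall_mem_cocycles (fun i ↦ U i ∩ W) hVW hψWc⟩ = 0 := by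
    rw [← hres0, ADoubleComplex.RowAugmentation.Hom.cohMap_mk]
    congr 1
  -- (5) so `ζ|_W` is a coboundary of the cochains of `W` (small cochains detect coboundaries)
  obtain ⟨φ', hφ'⟩ := exists_cod_eq_of_mk_toSmall_eq_zero (fun i ↦ U i ∩ W) (fun i ↦ (hUo i).inter hW) hVW
    (fun x hx ↦ by
      obtain ⟨i, hi⟩ := hcov x
      exact mem_iUnion.2 ⟨i, hi, hx⟩) ψW hψWc hsmall0
  -- (6) read it in the singular cochains of the subspace `↥W`
  rw [singularCohomology.map_π, singularCohomology.π_eq_zero_iff_exists, exists_d_prev_succ_iff]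
  refine ⟨fun τ ↦ (evalSimplex φ' (τ.map (valMap' W))).down, ?_⟩
  have hrange : ∀ {n : ℕ} (σ : SingularSimplex (↥W) n), (σ.map (valMap' W)).range ⊆ W := fun σ ↦ by
    rw [SingularSimplex.range_map]
    rintro _ ⟨y, -, rfl⟩
    exact y.2
  funext σ
  rw [coboundary_eq, singularCochainComplex.d_apply, ← coFn_eq, coFn_cocyclesMap,
    singularCochainComplex.map_apply]
  have key := congrArg (fun ψ ↦ (evalSimplex ψ (σ.map (valMap' W))).down) hφ'
  rw [hψW, evalSimplex_cres _ _ (hrange σ), evalSimplex_intCochain, evalSimplex_cod _ (hrange σ),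
    IntCoeff.down_sum] at key
  dsimp only at key
  rw [← key]
  refine Finset.sum_congr rfl fun i _ ↦ ?_
  rw [ULift.smul_down, smul_eq_mul, smul_eq_mul, SingularSimplex.face_map]

end Topology

/-! ### On a Hodge model: integral `(1,1)`-classes die off a proper closed analytic subset -/

section Model

variable {n : ℕ} {X : Motives.SchemeOver ℂ}

/-- **Non-zero sections of `L ⊗ 𝒪_X(D)^an` and of `𝒪_X(D)^an`** for every holomorphic line cocycle `L`
on a Hodge model of a smooth projective `X`: Kodaira–Serre sections of an algebraic twist (the tree's
`kodairaSerre_exists_globalSection_algebraicTwist_holds`) and the analytification `s^an` of a non-zero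
algebraic section `s ∈ Γ(X, 𝒪_X(D))` (coordinates `(f_i s)(φ m)`, as in
`lefschetzOneOne_rational_of_kodairaSerre`). [cite: VoisinHodgeI2002, Cor. 11.34 (proof)]
[cite: SerreGAGA1956, n° 16–17] -/
theorem exists_globalSections_of_kodairaSerre :
    ∀ ⦃n : ℕ⦄ ⦃X : Motives.SchemeOver ℂ⦄, Motives.IsSmoothProjective n X → ∀ (A : HodgeModel n X)
      (ι : Type) (L : HolomorphicLineBundle ι A.model A.carrier),
      ∃ (κ : Type) (L' : HolomorphicLineBundle κ A.model A.carrier)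
        (σ₁ : (L.tensor L').GlobalSection) (σ₂ : L'.GlobalSection),
        σ₁.zeroSet ≠ Set.univ ∧ σ₂.zeroSet ≠ Set.univ := by
  intro n X hX A ι L
  letI : AlgebraicGeometry.IsIntegral X.left := Motives.IsSmoothProjective.isIntegral_holds hX
  haveI := hX.smoothOfRelativeDimension
  haveI : AlgebraicGeometry.Smooth X.hom := AlgebraicGeometry.SmoothOfRelativeDimension.smooth n X.hom
  obtain ⟨D, s, hs, hs0, σ, hσ⟩ := kodairaSerre_exists_globalSection_algebraicTwist_holds hX A ι L
  -- adapted from `lefschetzOneOne_rational_of_kodairaSerre`: `σ₂ = s^an`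
  let τ : (cartierDivisorLineBundle A.isAnalytification D).GlobalSection :=
    ⟨fun i ↦ D.sectionCoord A.toComplexPoints hs i,
      fun i ↦ mdifferentiableOn_sectionCoord A.isAnalytification hs i,
      fun _ _ _ hm ↦ sectionCoord_eq_mul hs hm.1 hm.2⟩
  have hτ : τ.zeroSet ≠ univ := by
    haveI : JacobsonSpace X.left := AlgebraicGeometry.LocallyOfFiniteType.jacobsonSpace X.hom
    obtain ⟨y, hyU, hy⟩ :=
      nonempty_inter_closedPoints (D.nonvanishing_nonempty hs0) (D.isOpen_nonvanishing s).isLocallyClosed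
    set P : Motives.ComplexPoints X := (Motives.ComplexPoints.equivClosedPoints X).symm ⟨y, hy⟩ with hP
    have hPpt : P.pt = y := by
      have h := Motives.ComplexPoints.coe_equivClosedPoints_apply X P
      rw [hP, Equiv.apply_symm_apply] at h
      exact h.symm
    obtain ⟨m, hm⟩ := A.isAnalytification.isHomeomorph.surjective P
    have hmU : (A.toComplexPoints m).pt ∈ D.nonvanishing s := by
      rw [hm, hPpt]
      exact hyU
    rw [Ne, eq_univ_iff_forall, not_forall]
    exact ⟨m, fun ⟨i, hi, h0⟩ ↦ sectionCoord_ne_zero hs hi hmU h0⟩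
  exact ⟨D.ι, cartierDivisorLineBundle A.isAnalytification D, σ, τ, hσ, hτ⟩

/-- **Integral classes of type `(1,1)` die off a proper closed analytic subset, on a Hodge model.**
For `X` smooth projective over `ℂ`, a Hodge model `A` of `X` and `z ∈ H²(A.carrier; ℤ)` whose
complexification lies in `A.hodgePQ 2 1 1`, there is a closed analytic `S ≠ A.carrier` with
`z|_{A.carrier ∖ S} = 0` in INTEGRAL cohomology (Voisin I, Thm. 11.30 with Remark 7.9 — the torsion
is kept — and Thm. 11.33: the exponential cocycle of `z` presents a holomorphic line bundle, trivial
off the zeros of Kodaira–Serre sections, and the integer Čech cocycle of a trivialised exponential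
cocycle dies). [cite: VoisinHodgeI2002, Thm. 11.30, Rem. 7.9 and Thm. 11.33 (proof)] -/
theorem integralClass_oneOne_map_eq_zero_hodgeModel (hX : Motives.IsSmoothProjective n X)
    (A : HodgeModel n X) (z : singularCohomology ℤ ℤ A.carrier 2)
    (hz : singularCohomology.ringChange (Int.castRingHom ℂ) A.carrier 2 z ∈ A.hodgePQ 2 1 1) :
    ∃ S : Set A.carrier, Literature.Geometry.Kaehler.IsAnalyticSet 𝓘(ℂ, A.model) S ∧ S ≠ univ ∧
      singularCohomology.map ℤ ℤ (valMap' Sᶜ) 2 z = 0 := by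
  classical
  -- a representing integer cocycle `u`, with values `ζ`
  induction z using singularCohomology_induction_on with
  | h u =>
  set ζ : SingularSimplex A.carrier 2 → ℤ := coFn u with hζdef
  have hζ := sum_face_eq_zero_of_cocycles u
  -- the carrier is compact
  haveI : AlgebraicGeometry.IsProper X.hom := Motives.IsSmoothProjective.isProper_holds hX
  haveI : CompactSpace (Motives.ComplexPoints X) := Motives.compactSpace_algPoints_of_isProper_holds X ℂ
  haveI : CompactSpace A.carrier := A.isAnalytification.homeomorph.symm.compactSpace
  -- the complexified class is integral and, by rigidity, in `e₀(H^{1,1})` for de Rham's integration `e₀`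
  set β := singularCohomology.ringChange (Int.castRingHom ℂ) A.carrier 2 (singularCohomology.π ℤ ℤ A.carrier 2 u)
    with hβdef
  have hcplx : cocyclesRingChange (Int.castRingHom ℂ) 2 u = complexCocycle ζ hζ :=
    coFn_injective (by rw [coFn_cocyclesRingChange, complexCocycle, coFn_cocyclesMk]; rfl)
  have hβπ : β = singularCohomology.π ℂ ℂ A.carrier 2 (complexCocycle ζ hζ) := by
    rw [hβdef, singularCohomology.ringChange_π, hcplx]
  have hβi : IsIntegralClass β := ⟨complexCocycle ζ hζ, hβπ.symm, fun σ ↦ ⟨ζ σ, by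
    rw [iCocycles_complexCocycle]⟩⟩
  set e₀ := (integrationDeRhamIsoFamily A.model).complexify with he₀
  have he₀n : e₀.IsNatural := DeRhamIsoFamily.complexify_isNatural integrationDeRhamIsoFamily_isNatural
  obtain ⟨r, hr⟩ := exists_eq_smul_of_rigidity NaturalDeRhamComparisonRigidity_holds A.model A.deRham
    A.deRham_isNatural e₀ he₀n A.carrier 2
  have hz' : β ∈ (Literature.NumberTheory.Transcendental.hodgePQ A.model A.carrier 2 1 1).map
      (A.deRham A.carrier 2).toLinearMap := hz
  obtain ⟨w, hw, hwβ⟩ := hz'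
  rw [LinearEquiv.coe_toLinearMap] at hwβ
  have hβe : β ∈ (Literature.NumberTheory.Transcendental.hodgePQ A.model A.carrier 2 1 1).map
      (e₀ A.carrier 2).toLinearMap := by
    by_cases hr0 : r = 0
    · have hw0 : w = 0 := by
        rw [← (e₀ A.carrier 2).map_eq_zero_iff, hr w, hr0, zero_smul]
      rw [← hwβ, hw0, map_zero]
      exact Submodule.zero_mem _
    · refine ⟨r⁻¹ • w, Submodule.smul_mem _ _ hw, ?_⟩
      rw [LinearEquiv.coe_toLinearMap, map_smul, hr w, smul_smul, inv_mul_cancel₀ hr0, one_smul, hwβ]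
  -- Step 1: a real closed `(1,1)` representative; a chart-convex cover; the exponential cocycle
  obtain ⟨θ, hθ, hθt, hθr, hβθ⟩ := exists_real_closed_oneOne_rep β hβi hβe
  have hθs : IsSmoothForm θ := ((mem_cclosedSmoothForms_iff θ).1 hθ).1
  have hθc : IsClosedForm θ := ((mem_cclosedSmoothForms_iff θ).1 hθ).2
  obtain ⟨sι, ⟨𝒰⟩⟩ := exists_chartConvexCover (E := A.model) (M := A.carrier)
  have hθζ : e₀ A.carrier 2 (complexDeRhamCohomology.mk A.model A.carrier 2 ⟨θ, mem_cclosedSmoothForms hθs hθc⟩) =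
      singularCohomology.π ℂ ℂ A.carrier 2 (complexCocycle ζ hζ) := by
    rw [← hβπ, hβθ]
  obtain ⟨G, b, Y, hG, hGb, hb4, hY, hbY⟩ := exists_expCocycle_of_intCocycle 𝒰 hθs hθc hθt hθr ζ hζ hθζ
  have hcov : ∀ x, ∃ i, x ∈ 𝒰.U i := fun x ↦ by
    have hx : x ∈ ⋃ i, 𝒰.U i := by rw [𝒰.iUnion_eq]; exact mem_univ x
    exact mem_iUnion.1 hx
  have hcoc := HolomorphicLineBundle.exp_mul_exp_eq_exp_of_exists_int (U := 𝒰.U) (f := G)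
    fun i j k x hx ↦ ⟨-b i j k, by rw [hGb i j k x hx]; push_cast; ring⟩
  set L := HolomorphicLineBundle.ofExp 𝒰.U 𝒰.isOpen hcov G hG hcoc with hL
  -- Kodaira–Serre sections: `L` is trivial off a proper closed analytic subset
  obtain ⟨S, hSan, hSne, s, hs, hs0, hsg⟩ :=
    isTrivialOn_compl_analyticSet_of_globalSections exists_globalSections_of_kodairaSerre hX A _ L
  refine ⟨S, hSan, hSne, ?_⟩
  -- the topological end
  exact map_π_eq_zero_of_units 𝒰.U 𝒰.isOpen hcov u hb4 hY hbY G
    (fun i j ↦ (hG i j).continuousOn) hGb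
    hSan.isClosed.isOpen_compl s (fun i ↦ (hs i).continuousOn) hs0
    fun i j x hx ↦ hsg i j x ⟨⟨hx.1.1, hx.2.1⟩, hx.1.2⟩

end Model

/-! ### The algebraic statement -/

section Algebraic

open CategoryTheory

variable {n : ℕ} {X : Motives.SchemeOver ℂ}

/-- **The Lefschetz theorem on `(1,1)`-classes with integral coefficients.** For `X` smooth
projective over `ℂ` and an integral class `z ∈ H²(X(ℂ); ℤ)` whose complexification is of Hodge type
`(1,1)`, there is a Zariski-closed `Z ≠ X` such that `z` restricts to `0` in `H²((X ∖ Z)(ℂ); ℤ)`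
(Voisin I, Thm. 11.30 with Remark 7.9 and Thm. 11.33: `z = c₁(𝒪_X(D))` dies off `supp D`; here: the
Hodge-model statement `integralClass_oneOne_map_eq_zero_hodgeModel` and Chow's theorem
`chow_analyticSet_analytification_holds`). Torsion classes are included: they are exactly the
integral classes with zero complexification. [cite: VoisinHodgeI2002, Thm. 11.30, Rem. 7.9, Thm. 11.33]
[cite: SerreGAGA1956, §19 Prop. 13] -/
theorem integralLefschetzOneOne (hX : Motives.IsSmoothProjective n X)
    (z : singularCohomology ℤ ℤ (Motives.ComplexPoints X) 2)
    (hz : IsOfHodgeType n X 2 1 1 (singularCohomology.ringChange (Int.castRingHom ℂ) (Motives.ComplexPoints X) 2 z)) :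
    ∃ Z : Set X.left, IsClosed Z ∧ Z ≠ Set.univ ∧
      singularCohomology.map ℤ ℤ
        (⟨Subtype.val, continuous_subtype_val⟩ : C(Motives.complexPointsCompl X Z, Motives.ComplexPoints X)) 2 z = 0 := by
  obtain ⟨A, hA⟩ := hz
  set φc : C(A.carrier, Motives.ComplexPoints X) := ⟨A.toComplexPoints, A.isAnalytification.isHomeomorph.continuous⟩
  set z' := singularCohomology.map ℤ ℤ φc 2 z with hz'def
  have hz' : singularCohomology.ringChange (Int.castRingHom ℂ) A.carrier 2 z' ∈ A.hodgePQ 2 1 1 := by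
    rw [hz'def, singularCohomology.ringChange_map]
    exact hA
  obtain ⟨S, hS, hSne, hS0⟩ := integralClass_oneOne_map_eq_zero_hodgeModel hX A z' hz'
  obtain ⟨Z, hZc, hSZ⟩ := chow_analyticSet_analytification_holds hX A.isAnalytification S hS
  have hZne : Z ≠ Set.univ := by
    rintro rfl
    refine hSne ?_
    rw [hSZ]
    exact Set.eq_univ_of_forall fun m ↦ Set.mem_univ _
  refine ⟨Z, hZc, hZne, ?_⟩
  -- transport along the homeomorphism `A.carrier ∖ S ≃ (X ∖ Z)(ℂ)`
  have hiff : ∀ m : A.carrier, m ∈ Sᶜ ↔ (A.isAnalytification.homeomorph m).pt ∉ Z := by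
    intro m
    rw [Set.mem_compl_iff, hSZ]
    rfl
  let ψ : ↥Sᶜ ≃ₜ Motives.complexPointsCompl X Z := A.isAnalytification.homeomorph.subtype hiff
  let ψc : C(↥Sᶜ, Motives.complexPointsCompl X Z) := ψ
  let ψc' : C(Motives.complexPointsCompl X Z, ↥Sᶜ) := ψ.symm
  have hsq : (⟨Subtype.val, continuous_subtype_val⟩ :
        C(Motives.complexPointsCompl X Z, Motives.ComplexPoints X)).comp ψc = φc.comp (valMap' Sᶜ) := by
    ext m
    rfl
  have hli : Function.LeftInverse (singularCohomology.map ℤ ℤ ψc' 2) (singularCohomology.map ℤ ℤ ψc 2) := by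
    intro y
    change ((singularCohomology.mapIso ℤ ℤ ψ 2).hom ≫ (singularCohomology.mapIso ℤ ℤ ψ 2).inv) y = y
    rw [CategoryTheory.Iso.hom_inv_id]
    rfl
  apply hli.injective
  rw [map_zero]
  change (singularCohomology.map ℤ ℤ _ 2 ≫ singularCohomology.map ℤ ℤ ψc 2) z = 0
  rw [← singularCohomology.map_comp, hsq, singularCohomology.map_comp]
  change singularCohomology.map ℤ ℤ (valMap' Sᶜ) 2 (singularCohomology.map ℤ ℤ φc 2 z) = 0
  exact hS0

end Algebraic

end Literature.AlgebraicGeometry.HodgeTheory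

end
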